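import Summits.RiemannHypothesis.RiemannHypothesis.Theorems.SuzukiWindowsDoorExplicitWindow

/-!
# SuzukiWindowsDoorExplicitWindowPolar — explicit unit-eigenvalue-free windows for `𝖪_θ[t]` keeping the polar factor (column DBR; RH-FREE)

RH-FREE throughout; nothing here bears on the truth of RH (a clean window certifies nothing about RH; every
window below is a finite instance of the `∀ t`-clause of the RH-EQUIVALENT residual `AllWindowsWitness`, never
evidence for it).  Refines `SuzukiWindowsDoorExplicitSymbol` / `…ExplicitWindow` ([Su20] = Suzuki, ASPM 84 (2020),
Thm 1.2 (K-v) with an explicit `τ`) by KEEPING the polar terms of the explicit formula: for `Re s = σ > 1`,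
`Re 1/(2s) + Re 1/(s−1) ≥ (3σ/2 − 1)/‖s‖²`, so `‖Θ_θ‖ ≤ (2π)^θ e^{2θε(σ)} ‖s‖^{−θ} e^{−aσ²/‖s‖²}`, `a = θ(3σ−2)/σ²`,
and by convexity (`1 − 1/y ≤ log y`) `e^{−aσ²/‖s‖²} ≤ e^{−a}(‖s‖/σ)^{2a}`; the price is the Bernoulli exponent
`θ_e = θ − 2a` in place of `θ`.  On the saddle line `σ = (θ−1)/x` this gives the ENVELOPE
`|K_θ(x)| ≤ A x^{θ−1} e^{−βx + γx²}`, `β = ½ + 3θ/(θ−1)`, `γ = 2θ/(θ−1)²`, and with the tangent bound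
`u^m e^{−cu} ≤ T^m e^{−cT} e^{λ(u−T)}` (`λ = m/T − c`) the weighted Hilbert–Schmidt sum is
`h(t) ≤ A² T^{2θ−2} e^{−cT}/λ²`, `T = 2t`, `c = 2β − 2γT`.  Windows: `θ = 12: t ≤ ½`, `θ = 20: t ≤ 0.84`,
`θ = 24: t ≤ 0.95`, `θ = 40: t ≤ 8/5`, `θ = 8: t ≤ 7/20` (previous file: `0.42, 0.66, 0.78, 1.25`).
-/

noncomputable section

-- D-0017: `Summit.<S>.<S>.…` is the designed namespace of a single-problem summit.
set_option linter.dupNamespace false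

open MeasureTheory Set Filter Topology Complex

namespace Summit.RiemannHypothesis.RiemannHypothesis.Theorems.SuzukiWindowsDoorExplicitWindowPolar

open Literature.NumberTheory.LFunctions
open Summit.RiemannHypothesis.RiemannHypothesis.Theorems.SuzukiWindowsDoorExplicitSymbol
open Summit.RiemannHypothesis.RiemannHypothesis.Theorems.SuzukiWindowsDoorExplicitWindow

/-! ## §8.1 The polar terms and the convexity step -/

/-- For `Re s > 1`: `(3σ/2 − 1)/‖s‖² ≤ Re 1/(2s) + Re 1/(s−1)` (`Re 1/(2s) = σ/(2‖s‖²)`, `‖s − 1‖ ≤ ‖s‖`). -/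
theorem re_polar_ge {s : ℂ} (hs : 1 < s.re) :
    (3 * s.re / 2 - 1) / ‖s‖ ^ 2 ≤ (1 / (2 * s)).re + (1 / (s - 1)).re := by
  have hs0 : s ≠ 0 := fun h => by rw [h] at hs; norm_num at hs
  have hns : 0 < Complex.normSq s := Complex.normSq_pos.mpr hs0
  have hs1 : s - 1 ≠ 0 := by
    intro h; rw [sub_eq_zero] at h; rw [h] at hs; norm_num at hs
  have hns1 : 0 < Complex.normSq (s - 1) := Complex.normSq_pos.mpr hs1
  have hsq : ‖s‖ ^ 2 = Complex.normSq s := Complex.sq_norm s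
  have hA : (1 / (2 * s)).re = s.re / 2 / Complex.normSq s := by
    have : (1 / (2 * s)) = ((1 / 2 : ℝ) : ℂ) * s⁻¹ := by push_cast; field_simp
    rw [this, Complex.re_ofReal_mul, Complex.inv_re]; ring
  have hB : (1 / (s - 1)).re = (s.re - 1) / Complex.normSq (s - 1) := by
    rw [one_div, Complex.inv_re, Complex.sub_re, Complex.one_re]
  have hle : Complex.normSq (s - 1) ≤ Complex.normSq s := by
    rw [Complex.normSq_apply, Complex.normSq_apply, Complex.sub_re, Complex.sub_im, Complex.one_re,
      Complex.one_im]
    nlinarith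
  have hC : (s.re - 1) / Complex.normSq s ≤ (s.re - 1) / Complex.normSq (s - 1) :=
    div_le_div_of_nonneg_left (by linarith) hns1 hle
  rw [hsq, hA, hB]
  have : (3 * s.re / 2 - 1) / Complex.normSq s = s.re / 2 / Complex.normSq s + (s.re - 1) / Complex.normSq s := by
    field_simp
    ring
  rw [this]; linarith

/-- Convexity: `exp(−a/y) ≤ e^{−a} y^{a}` for `y ≥ 1`, `a ≥ 0` (`1 − 1/y ≤ log y`). -/
theorem exp_neg_div_le {a y : ℝ} (ha : 0 ≤ a) (hy : 1 ≤ y) :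
    Real.exp (-a / y) ≤ Real.exp (-a) * y ^ a := by
  have hy0 : 0 < y := by linarith
  have hlog : 1 - y⁻¹ ≤ Real.log y := Real.one_sub_inv_le_log_of_pos hy0
  rw [Real.rpow_def_of_pos hy0, ← Real.exp_add, Real.exp_le_exp, div_eq_mul_inv]
  have h := mul_le_mul_of_nonneg_left hlog ha
  nlinarith

/-! ## §8.2 The refined symbol bound, its `u`-integral and the line bound for `K_θ` -/

/-- **Symbol bound keeping the polar factor** (RH-free): `σ = ½ + b ≥ 3`, `0 ≤ a ≤ θ(3σ−2)/σ²`,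
`2 ≤ θ_e ≤ θ − 2a`: `‖Θ_θ(u + ib)‖ ≤ (2π)^θ e^{2θε(σ)} e^{−a} σ^{−θ} (1 + θ_e u²/(2σ²))⁻¹`. -/
theorem norm_limTheta_le_polar {θ a θe b : ℝ} (hb : 5 / 2 ≤ b) (ha0 : 0 ≤ a)
    (ha : a * (1 / 2 + b) ^ 2 ≤ θ * (3 * (1 / 2 + b) - 2)) (hθe : 2 ≤ θe) (hθea : θe + 2 * a ≤ θ) (u : ℝ) :
    ‖limTheta θ ((u : ℂ) + (b : ℂ) * I)‖ ≤
      (2 * Real.pi) ^ θ * Real.exp (2 * θ * (1 / (6 * (1 / 2 + b) ^ 2) + 1 / (Real.pi * (1 / 2 + b) ^ 3)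
          + Real.pi ^ 2 / 6 * (2 : ℝ) ^ (3 - (1 / 2 + b)))) * Real.exp (-a)
        * (1 / 2 + b) ^ (-θ) * (1 + θe / (2 * (1 / 2 + b) ^ 2) * u ^ 2)⁻¹ := by
  set σ : ℝ := 1 / 2 + b with hσdef
  set ε : ℝ := 1 / (6 * σ ^ 2) + 1 / (Real.pi * σ ^ 3) + Real.pi ^ 2 / 6 * (2 : ℝ) ^ (3 - σ) with hεdef
  have hσ3 : 3 ≤ σ := by rw [hσdef]; linarith
  have hσ0 : 0 < σ := by linarith
  have hθ2 : 2 ≤ θ := by linarith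
  have hθe0 : 0 < θe := by linarith
  have hθe' : θe ≤ θ - 2 * a := by linarith
  rw [norm_limTheta]
  set s : ℂ := (1 : ℂ) / 2 - I * ((u : ℂ) + (b : ℂ) * I) with hsdef
  have hs : s = ((σ : ℝ) : ℂ) + ((-u : ℝ) : ℂ) * I := by
    rw [hsdef, hσdef]; push_cast; linear_combination (-(b : ℂ)) * I_mul_I
  have hsre : s.re = σ := by rw [hs]; simp
  have hsim : s.im = -u := by rw [hs]; simp
  have hnormsq : ‖s‖ ^ 2 = σ ^ 2 + u ^ 2 := by
    rw [Complex.sq_norm, Complex.normSq_apply, hsre, hsim]; ring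
  have hσle : σ ≤ ‖s‖ := by rw [← hsre]; exact Complex.re_le_norm s
  have hnorm0 : 0 < ‖s‖ := lt_of_lt_of_le hσ0 hσle
  have hlow := re_logDeriv_riemannXi_ge_explicit (s := s) (by rw [hsre]; linarith)
  rw [hsre] at hlow
  have hP := re_polar_ge (s := s) (by rw [hsre]; linarith)
  rw [hsre] at hP
  have hZ := tsum_norm_term_vonMangoldt_le hσ3
  have hsq : σ ^ 2 ≤ ‖s‖ ^ 2 := pow_le_pow_left₀ hσ0.le hσle 2
  have hA : 1 / (6 * ‖s‖ ^ 2) ≤ 1 / (6 * σ ^ 2) := by gcongr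
  have hB : 1 / (Real.pi * σ * ‖s‖ ^ 2) ≤ 1 / (Real.pi * σ ^ 3) := by
    rw [show Real.pi * σ ^ 3 = Real.pi * σ * σ ^ 2 by ring]; gcongr
  have hLD : Real.log (‖s‖ / (2 * Real.pi)) / 2 + (3 * σ / 2 - 1) / ‖s‖ ^ 2 - ε
      ≤ (logDeriv riemannXi s).re := by
    rw [hεdef]; linarith
  have hpol : a * σ ^ 2 / ‖s‖ ^ 2 ≤ 2 * θ * ((3 * σ / 2 - 1) / ‖s‖ ^ 2) := by
    rw [show 2 * θ * ((3 * σ / 2 - 1) / ‖s‖ ^ 2) = θ * (3 * σ - 2) / ‖s‖ ^ 2 by ring]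
    exact div_le_div_of_nonneg_right ha (by positivity)
  have hθ0 : 0 ≤ θ := by linarith
  have step : -2 * θ * (logDeriv riemannXi s).re ≤
      Real.log (‖s‖ / (2 * Real.pi)) * (-θ) + 2 * θ * ε + -(a * σ ^ 2 / ‖s‖ ^ 2) := by
    have := mul_le_mul_of_nonneg_left hLD (by linarith : 0 ≤ 2 * θ)
    nlinarith
  have hq0 : 0 < ‖s‖ / (2 * Real.pi) := by positivity
  have hmain : Real.exp (-2 * θ * (logDeriv riemannXi s).re) ≤
      (2 * Real.pi) ^ θ * Real.exp (2 * θ * ε) * ‖s‖ ^ (-θ) * Real.exp (-(a * σ ^ 2 / ‖s‖ ^ 2)) := by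
    calc Real.exp (-2 * θ * (logDeriv riemannXi s).re)
        ≤ Real.exp (Real.log (‖s‖ / (2 * Real.pi)) * (-θ) + 2 * θ * ε + -(a * σ ^ 2 / ‖s‖ ^ 2)) :=
          Real.exp_le_exp.2 step
      _ = (‖s‖ / (2 * Real.pi)) ^ (-θ) * Real.exp (2 * θ * ε) * Real.exp (-(a * σ ^ 2 / ‖s‖ ^ 2)) := by
          rw [Real.exp_add, Real.exp_add, Real.rpow_def_of_pos hq0]
      _ = (2 * Real.pi) ^ θ * Real.exp (2 * θ * ε) * ‖s‖ ^ (-θ) * Real.exp (-(a * σ ^ 2 / ‖s‖ ^ 2)) := by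
          rw [Real.div_rpow hnorm0.le (by positivity), Real.rpow_neg (by positivity : (0:ℝ) ≤ 2 * Real.pi),
            div_inv_eq_mul]
          ring
  -- convexity step, with `y = ‖s‖²/σ² ≥ 1`
  have hy1 : 1 ≤ ‖s‖ ^ 2 / σ ^ 2 := by rw [le_div_iff₀ (by positivity)]; linarith
  have hconv : Real.exp (-(a * σ ^ 2 / ‖s‖ ^ 2)) ≤ Real.exp (-a) * (‖s‖ ^ 2 / σ ^ 2) ^ a := by
    have h := exp_neg_div_le ha0 hy1
    have : -a / (‖s‖ ^ 2 / σ ^ 2) = -(a * σ ^ 2 / ‖s‖ ^ 2) := by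
      field_simp
    rwa [this] at h
  have e1 : (‖s‖ ^ 2 / σ ^ 2) ^ a = ‖s‖ ^ (2 * a) / σ ^ (2 * a) := by
    rw [Real.div_rpow (by positivity) (by positivity), ← Real.rpow_two, ← Real.rpow_two,
      ← Real.rpow_mul hnorm0.le, ← Real.rpow_mul hσ0.le]
  have e2 : ‖s‖ ^ (-θ) * (‖s‖ ^ (2 * a) / σ ^ (2 * a)) = ‖s‖ ^ (-(θ - 2 * a)) * σ ^ (-(2 * a)) := by
    rw [Real.rpow_neg hσ0.le (2 * a), show -(θ - 2 * a) = -θ + 2 * a by ring, Real.rpow_add hnorm0]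
    ring
  have hbern := rpow_neg_le_of_sq_eq (θ := θ - 2 * a) (by linarith) hσ0 hnorm0.le hnormsq
  have hmono : (1 + (θ - 2 * a) / (2 * σ ^ 2) * u ^ 2)⁻¹ ≤ (1 + θe / (2 * σ ^ 2) * u ^ 2)⁻¹ := by
    apply inv_anti₀ (by positivity)
    gcongr
  have hσpow : σ ^ (-(θ - 2 * a)) * σ ^ (-(2 * a)) = σ ^ (-θ) := by
    rw [← Real.rpow_add hσ0]; congr 1; ring
  calc Real.exp (-2 * θ * (logDeriv riemannXi s).re)
      ≤ (2 * Real.pi) ^ θ * Real.exp (2 * θ * ε) * ‖s‖ ^ (-θ) * Real.exp (-(a * σ ^ 2 / ‖s‖ ^ 2)) := hmain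
    _ ≤ (2 * Real.pi) ^ θ * Real.exp (2 * θ * ε) * ‖s‖ ^ (-θ) * (Real.exp (-a) * (‖s‖ ^ 2 / σ ^ 2) ^ a) := by
        gcongr
    _ = (2 * Real.pi) ^ θ * Real.exp (2 * θ * ε) * Real.exp (-a)
          * (‖s‖ ^ (-θ) * (‖s‖ ^ (2 * a) / σ ^ (2 * a))) := by rw [e1]; ring
    _ = (2 * Real.pi) ^ θ * Real.exp (2 * θ * ε) * Real.exp (-a) * (‖s‖ ^ (-(θ - 2 * a)) * σ ^ (-(2 * a))) := by
        rw [e2]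
    _ ≤ (2 * Real.pi) ^ θ * Real.exp (2 * θ * ε) * Real.exp (-a)
          * ((σ ^ (-(θ - 2 * a)) * (1 + θe / (2 * σ ^ 2) * u ^ 2)⁻¹) * σ ^ (-(2 * a))) := by
        gcongr
        exact hbern.trans (mul_le_mul_of_nonneg_left hmono (by positivity))
    _ = (2 * Real.pi) ^ θ * Real.exp (2 * θ * ε) * Real.exp (-a) * σ ^ (-θ)
          * (1 + θe / (2 * σ ^ 2) * u ^ 2)⁻¹ := by rw [← hσpow]; ring

/-- The `u`-integral of the refined majorant: `∫ ‖Θ_θ(u + ib)‖ du ≤ (2π)^θ e^{2θε(σ)} e^{−a} σ^{−θ} · πσ√(2/θ_e)`. -/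
theorem integral_norm_limTheta_le_polar {θ a θe b : ℝ} (hb : 5 / 2 ≤ b) (ha0 : 0 ≤ a)
    (ha : a * (1 / 2 + b) ^ 2 ≤ θ * (3 * (1 / 2 + b) - 2)) (hθe : 2 ≤ θe) (hθea : θe + 2 * a ≤ θ) :
    ∫ u : ℝ, ‖limTheta θ ((u : ℂ) + (b : ℂ) * I)‖ ≤
      (2 * Real.pi) ^ θ * Real.exp (2 * θ * (1 / (6 * (1 / 2 + b) ^ 2) + 1 / (Real.pi * (1 / 2 + b) ^ 3)
          + Real.pi ^ 2 / 6 * (2 : ℝ) ^ (3 - (1 / 2 + b)))) * Real.exp (-a)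
        * (1 / 2 + b) ^ (-θ) * (Real.pi * (1 / 2 + b) * Real.sqrt (2 / θe)) := by
  set σ : ℝ := 1 / 2 + b with hσdef
  set C : ℝ := (2 * Real.pi) ^ θ * Real.exp (2 * θ * (1 / (6 * σ ^ 2) + 1 / (Real.pi * σ ^ 3)
          + Real.pi ^ 2 / 6 * (2 : ℝ) ^ (3 - σ))) * Real.exp (-a) * σ ^ (-θ) with hCdef
  have hσ0 : 0 < σ := by rw [hσdef]; linarith
  have hθe0 : 0 < θe := by linarith
  have hc : 0 < θe / (2 * σ ^ 2) := by positivity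
  have hmaj : ∀ u : ℝ, ‖limTheta θ ((u : ℂ) + (b : ℂ) * I)‖ ≤ C * (1 + θe / (2 * σ ^ 2) * u ^ 2)⁻¹ :=
    fun u => norm_limTheta_le_polar hb ha0 ha hθe hθea u
  have hint : Integrable fun u : ℝ => C * (1 + θe / (2 * σ ^ 2) * u ^ 2)⁻¹ :=
    (integrable_inv_one_add_mul_sq hc).const_mul C
  calc ∫ u : ℝ, ‖limTheta θ ((u : ℂ) + (b : ℂ) * I)‖
      ≤ ∫ u : ℝ, C * (1 + θe / (2 * σ ^ 2) * u ^ 2)⁻¹ :=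
        integral_mono_of_nonneg (Eventually.of_forall fun u => norm_nonneg _) hint
          (Eventually.of_forall hmaj)
    _ = C * (Real.pi / Real.sqrt (θe / (2 * σ ^ 2))) := by
        rw [integral_const_mul, integral_inv_one_add_mul_sq hc]
    _ = C * (Real.pi * σ * Real.sqrt (2 / θe)) := by rw [pi_div_sqrt_eq hθe0 hσ0]

/-- **Line bound for `K_θ` keeping the polar factor** (RH-free; line `σ = ½ + b ≥ 3`, `0 ≤ a ≤ θ(3σ−2)/σ²`,
`2 ≤ θ_e ≤ θ − 2a`, all real `x`): `|K_θ(x)| ≤ (2π)^{θ−1} π√(2/θ_e) e^{2θε(σ)} e^{−a} σ^{1−θ} e^{bx}`. -/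
theorem abs_limKernel_le_line_polar {θ a θe b : ℝ} (hb : 5 / 2 ≤ b) (ha0 : 0 ≤ a)
    (ha : a * (1 / 2 + b) ^ 2 ≤ θ * (3 * (1 / 2 + b) - 2)) (hθe : 2 ≤ θe) (hθea : θe + 2 * a ≤ θ) (x : ℝ) :
    |limKernel θ x| ≤
      (2 * Real.pi) ^ (θ - 1) * (Real.pi * Real.sqrt (2 / θe))
        * Real.exp (2 * θ * (1 / (6 * (1 / 2 + b) ^ 2) + 1 / (Real.pi * (1 / 2 + b) ^ 3)
          + Real.pi ^ 2 / 6 * (2 : ℝ) ^ (3 - (1 / 2 + b)))) * Real.exp (-a)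
        * (1 / 2 + b) ^ (1 - θ) * Real.exp (b * x) := by
  set σ : ℝ := 1 / 2 + b with hσdef
  set X : ℝ := Real.exp (2 * θ * (1 / (6 * σ ^ 2) + 1 / (Real.pi * σ ^ 3)
          + Real.pi ^ 2 / 6 * (2 : ℝ) ^ (3 - σ))) with hXdef
  have hσ0 : 0 < σ := by rw [hσdef]; linarith
  have hθ1 : 1 < θ := by linarith
  have hb' : 1 / 2 < b := by linarith
  have hI := integral_norm_limTheta_le_polar hb ha0 ha hθe hθea
  have h2pi : (0 : ℝ) < 2 * Real.pi := by positivity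
  calc |limKernel θ x| = |(invFourierLine (limTheta θ) 1 x).re| := rfl
    _ ≤ ‖invFourierLine (limTheta θ) 1 x‖ := Complex.abs_re_le_norm _
    _ = ‖invFourierLine (limTheta θ) b x‖ := by rw [invFourierLine_limTheta_eq hθ1 (by norm_num) hb']
    _ ≤ 1 / (2 * Real.pi) * Real.exp (b * x) * ∫ u : ℝ, ‖limTheta θ ((u : ℂ) + (b : ℂ) * I)‖ :=
        norm_invFourierLine_le _ _ _
    _ ≤ 1 / (2 * Real.pi) * Real.exp (b * x) *
        ((2 * Real.pi) ^ θ * X * Real.exp (-a) * σ ^ (-θ) * (Real.pi * σ * Real.sqrt (2 / θe))) := by gcongr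
    _ = (2 * Real.pi) ^ (θ - 1) * (Real.pi * Real.sqrt (2 / θe)) * X * Real.exp (-a) * σ ^ (1 - θ)
        * Real.exp (b * x) := by
        rw [Real.rpow_sub_one h2pi.ne', show (1 : ℝ) - θ = 1 + (-θ) by ring, Real.rpow_add hσ0,
          Real.rpow_one]
        field_simp

/-! ## §8.3 The envelope on the saddle line: `|K_θ(x)| ≤ A x^{θ−1} e^{−βx + γx²}` -/

/-- **ENVELOPE WITH THE POLAR FACTOR** (RH-free): for `σ₀ ≥ 3`, `0 < x`, `xσ₀ ≤ θ − 1`, and `2 ≤ θ_e` with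
`θ_e + 2a(x) ≤ θ`, `a(x) = 3θx/(θ−1) − 2θx²/(θ−1)²` (`= θ(3σ−2)/σ²` on the line `σ = (θ−1)/x`):
`|K_θ(x)| ≤ (2π)^{θ−1} π√(2/θ_e) (e/(θ−1))^{θ−1} e^{2θε(σ₀)} · x^{θ−1} · exp(−(½ + 3θ/(θ−1))x + 2θx²/(θ−1)²)`. -/
theorem abs_limKernel_le_onset_polar {θ θe σ₀ x : ℝ} (hσ₀ : 3 ≤ σ₀) (hx : 0 < x) (hxσ : x * σ₀ ≤ θ - 1)
    (hθe : 2 ≤ θe) (hθea : θe + 2 * (3 * θ * x / (θ - 1) - 2 * θ * x ^ 2 / (θ - 1) ^ 2) ≤ θ) :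
    |limKernel θ x| ≤
      (2 * Real.pi) ^ (θ - 1) * (Real.pi * Real.sqrt (2 / θe)) * (Real.exp 1 / (θ - 1)) ^ (θ - 1)
        * Real.exp (2 * θ * (1 / (6 * σ₀ ^ 2) + 1 / (Real.pi * σ₀ ^ 3) + Real.pi ^ 2 / 6 * (2 : ℝ) ^ (3 - σ₀)))
        * x ^ (θ - 1) * Real.exp (-(1 / 2 + 3 * θ / (θ - 1)) * x + 2 * θ / (θ - 1) ^ 2 * x ^ 2) := by
  set a : ℝ := 3 * θ * x / (θ - 1) - 2 * θ * x ^ 2 / (θ - 1) ^ 2 with hadef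
  set σ : ℝ := (θ - 1) / x with hσdef
  set b : ℝ := σ - 1 / 2 with hbdef
  have hσ₀0 : 0 < σ₀ := by linarith
  have hθ1 : 0 < θ - 1 := by nlinarith
  have hθne : θ - 1 ≠ 0 := ne_of_gt hθ1
  have hσσ₀ : σ₀ ≤ σ := by rw [hσdef, le_div_iff₀ hx]; linarith
  have hσ0 : 0 < σ := lt_of_lt_of_le hσ₀0 hσσ₀
  have hb : 5 / 2 ≤ b := by rw [hbdef]; linarith
  have hσb : 1 / 2 + b = σ := by rw [hbdef]; ring
  have hσx : σ * x = θ - 1 := by rw [hσdef]; field_simp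
  have hx3 : 2 * x ≤ 3 * (θ - 1) := by nlinarith
  -- `a = θ(3σ−2)/σ²` on the line, and `a ≥ 0`
  have haσ : a * σ ^ 2 = θ * (3 * σ - 2) := by
    rw [hadef, hσdef]; field_simp
  have ha0 : 0 ≤ a := by
    have : a = θ * x * (3 * (θ - 1) - 2 * x) / (θ - 1) ^ 2 := by rw [hadef]; field_simp
    rw [this]
    have hθ0 : 0 ≤ θ := by linarith
    have h3 : 0 ≤ 3 * (θ - 1) - 2 * x := by linarith
    positivity
  have hline := abs_limKernel_le_line_polar (θ := θ) hb ha0 (by rw [hσb, haσ]) hθe hθea x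
  rw [hσb] at hline
  -- the factors on the line `σ = (θ−1)/x`
  have hexp : Real.exp (b * x) = Real.exp 1 ^ (θ - 1) * Real.exp (-(x / 2)) := by
    rw [Real.exp_one_rpow, ← Real.exp_add]; congr 1; rw [hbdef]; nlinarith
  have hpow : σ ^ (1 - θ) = (1 / (θ - 1)) ^ (θ - 1) * x ^ (θ - 1) := by
    have : σ = (θ - 1) * x⁻¹ := by rw [hσdef, div_eq_mul_inv]
    rw [this, show (1 : ℝ) - θ = -(θ - 1) by ring, Real.rpow_neg (by positivity),
      Real.mul_rpow hθ1.le (by positivity), Real.inv_rpow hx.le, one_div, Real.inv_rpow hθ1.le]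
    field_simp
  have heps := eps_antitone hσ₀0 hσσ₀
  set E₀ := Real.exp (2 * θ * (1 / (6 * σ₀ ^ 2) + 1 / (Real.pi * σ₀ ^ 3) + Real.pi ^ 2 / 6 * (2 : ℝ) ^ (3 - σ₀)))
    with hE₀
  have hθ0 : 0 ≤ θ := by linarith
  have hE : Real.exp (2 * θ * (1 / (6 * σ ^ 2) + 1 / (Real.pi * σ ^ 3) + Real.pi ^ 2 / 6 * (2 : ℝ) ^ (3 - σ)))
      ≤ E₀ := by
    rw [hE₀, Real.exp_le_exp]
    exact mul_le_mul_of_nonneg_left heps (by linarith)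
  have hea : Real.exp (-a) * Real.exp (-(x / 2)) =
      Real.exp (-(1 / 2 + 3 * θ / (θ - 1)) * x + 2 * θ / (θ - 1) ^ 2 * x ^ 2) := by
    rw [← Real.exp_add]; congr 1; rw [hadef]; ring
  set P : ℝ := (2 * Real.pi) ^ (θ - 1) * (Real.pi * Real.sqrt (2 / θe)) with hP
  have hP0 : 0 ≤ P := by positivity
  calc |limKernel θ x|
      ≤ P * Real.exp (2 * θ * (1 / (6 * σ ^ 2) + 1 / (Real.pi * σ ^ 3) + Real.pi ^ 2 / 6 * (2 : ℝ) ^ (3 - σ)))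
          * Real.exp (-a) * σ ^ (1 - θ) * Real.exp (b * x) := hline
    _ ≤ P * E₀ * Real.exp (-a) * σ ^ (1 - θ) * Real.exp (b * x) := by gcongr
    _ = P * (Real.exp 1 / (θ - 1)) ^ (θ - 1) * E₀ * x ^ (θ - 1) * (Real.exp (-a) * Real.exp (-(x / 2))) := by
        rw [hpow, hexp, div_eq_mul_one_div (Real.exp 1) (θ - 1),
          Real.mul_rpow (Real.exp_pos 1).le (by positivity)]
        ring
    _ = _ := by rw [hea]

end Summit.RiemannHypothesis.RiemannHypothesis.Theorems.SuzukiWindowsDoorExplicitWindowPolar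

end
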